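import Literature.Analysis.Asymptotics.KaramataPowerSeries
import Summits.QuantumFields.BalabanUV.Beta.EriceFlowEnclosureCesaroTauberianSeq
import Summits.QuantumFields.BalabanUV.Beta.EriceFlowEnclosureAbelMeanSeq

/-!
# Beta / EriceFlowEnclosureAbelTauberianSeq — THE EXPONENTIALLY WEIGHTED (ABEL) CUTOFF AVERAGE, TAUBERIAN SIDE: FOR A SEQUENCE BOUNDED
# BELOW, ABEL-SUMMABLE ⟺ (C,1)-SUMMABLE (Hardy–Littlewood–Karamata BY NAME + P2 #54a's inclusion), HENCE IN SCHMIDT'S CLASS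
# `(1 − x)·Σ a n xⁿ → m (x → 1⁻) ⟺ n⁻¹·Σ_{i<n} a i → m ⟺ a n → m` (pure [folklore] SERVICE for the BARE ∕ CUTOFF side of rows L131–L142;
# imports the tree's `Literature.Analysis.Asymptotics.KaramataPowerSeries` (Feller XIII.5 Thm 5), P2 #53a and P2 #54a).
#   §1 TAUBERIAN BY NAME — a BOUNDED BELOW + `Σ a n xⁿ` summable on [0,1[ + Abel → m ⟹ (C,1) → m (**`cesaro_of_abel_of_bddBelow`**: the tree's
#      `hardyLittlewood_powerSeries_iff` at index ρ = 1 for the nonnegative `q n = a n − b + 1`, Abel limit `m − b + 1 ≥ 1 > 0`, Γ(2) = 1);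
#      hence **`abel_iff_cesaro_of_bddBelow`** (⟸ P2 #54a `abel_of_cesaro`), and with ONE-SIDED SLOW DECREASE (P2 #53a
#      `tendsto_of_cesaro_slowlyDecreasing`) **`tendsto_of_abel_slowlyDecreasing_of_bddBelow`** ∕ **`abel_iff_tendsto_of_slowlyOscillating_of_bddBelow`**
#      (Littlewood 1911 ∕ Schmidt 1925 in the bounded-below class): ABEL ⟺ (C,1) ⟺ LIMIT;
#   §2 PERTURBATION BY A NULL SEQUENCE — for d = u + e, u (SO) and bounded below, e → 0: `Abel(d) → m ⟺ d → m ⟺ u → m` (`abel_add_null_iff`).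
# (β-flow team, prover 2 = lower ∕ positivity side, unit `b2b-balaban-beta-bflow-p2`, gen 37; module P2 #54b; no Erice sentence occurs)

HONEST FRAMING (page 1 of everything the β sub-cell writes): discharging `BetaPertH` makes Bałaban's UV stability UNCONDITIONAL — a
real constructive-QFT result; it is NOT the continuum limit and NOT the Clay problem.  HONEST DEPENDENCY (cell reorg 2026-08-19,
verbatim): «continuum YM on T⁴ ⇐ BetaPertH ∧ nine spine estimates (0/9 proved); BetaPertH ⇐ (D1) ∧ (D4) ∧ CAP+tail; G-an2-4 gates
asym, D1 and NE2/3/4.»  THIS MODULE DISCHARGES NOTHING and quotes nothing: [folklore] real analysis about real sequences (G. H. Hardy and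
J. E. Littlewood, Proc. LMS (2) 13 (1914) 174–191; J. Karamata, Math. Z. 32 (1930) 319–320; J. E. Littlewood, Proc. LMS (2) 9 (1911) 434–448;
R. Schmidt, Math. Z. 22 (1925) 89–152; Hardy, Divergent Series (1949) Thms 92–96, 105).  The Tauberian step is IMPORTED BY NAME from the
tree (`Literature.Analysis.Asymptotics.hardyLittlewood_powerSeries_iff`, Feller XIII.5 Theorem 5 with Karamata's proof; `lean search
hardyLittlewood|Karamata` → `Literature/Analysis/Asymptotics/Karamata*.lean`); Mathlib has no Tauberian converse of Abel's theorem.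

THE POINT.  POSITIVITY (a ≥ b, shifted to `q n = a n − b + 1 ≥ 0` with Abel limit `m − b + 1 > 0`) lets Karamata's theorem return the Cesàro
means from the Abel means; slow decrease then returns the sequence itself (P2 #53a).  So the exponential cutoff weights generate NO new limits
in the bounded-below slowly oscillating class — which is the two-loop clock's class (P2 #53b); the junction is P2 #54e.

WHAT THIS FILE PROVES (0 sorry, 0 def): §1 `le_of_abel_of_bddBelow`, **`cesaro_of_abel_of_bddBelow`**, **`abel_iff_cesaro_of_bddBelow`**,
**`tendsto_of_abel_slowlyDecreasing_of_bddBelow`**, **`abel_iff_tendsto_of_slowlyOscillating_of_bddBelow`**; §2 `bddBelow_add_null`, **`abel_add_null_iff`**.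
NOT CLAIMED: Littlewood's theorem WITHOUT the lower bound (slow decrease + Abel ⟹ bounded below, Hardy Thm 96 — not needed by the
consumer, whose sequences are bounded); complex ∕ Stolz-angle approach; logarithmic or power weights (P2 #54c ∕ #54d); anything about
β-functions (P2 #54e); `BetaPertH`; continuum; Clay.
-/

namespace Summit.QuantumFields.BalabanUV.Beta.EriceFlowEnclosureAbelTauberianSeq

open Finset Filter Topology
open Summit.QuantumFields.BalabanUV.Beta.EriceFlowEnclosureCesaroTauberianSeq
open Summit.QuantumFields.BalabanUV.Beta.EriceFlowEnclosureAbelMeanSeq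

noncomputable section

variable {a : ℕ → ℝ}

/-! ## §1 The Tauberian direction BY NAME (Hardy–Littlewood–Karamata) and the equivalences -/

/-- The Abel limit of a sequence bounded below by b is ≥ b. [folklore] -/
theorem le_of_abel_of_bddBelow {m b : ℝ} (hb : ∀ n, b ≤ a n)
    (hsum : ∀ x : ℝ, 0 ≤ x → x < 1 → Summable fun n => a n * x ^ n)
    (habel : Tendsto (fun x : ℝ => (1 - x) * ∑' n, a n * x ^ n) (𝓝[<] 1) (𝓝 m)) : b ≤ m := by
  refine ge_of_tendsto habel ?_
  filter_upwards [Ioo_mem_nhdsLT (show (0 : ℝ) < 1 by norm_num)] with x hx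
  obtain ⟨hx0, hx1⟩ := hx
  have h1x : 0 ≤ 1 - x := by linarith
  have hg : Summable fun n : ℕ => b * x ^ n := (summable_geometric_of_lt_one hx0.le hx1).mul_left b
  have h1 : ∑' n, b * x ^ n ≤ ∑' n, a n * x ^ n :=
    hg.tsum_le_tsum (fun n => mul_le_mul_of_nonneg_right (hb n) (pow_nonneg hx0.le n)) (hsum x hx0.le hx1)
  have h2 : (1 - x) * ∑' n, b * x ^ n = b := by
    rw [tsum_mul_left, ← mul_assoc, mul_comm (1 - x), mul_assoc, one_sub_mul_tsum_pow hx0.le hx1, mul_one]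
  calc b = (1 - x) * ∑' n, b * x ^ n := h2.symm
    _ ≤ (1 - x) * ∑' n, a n * x ^ n := mul_le_mul_of_nonneg_left h1 h1x

/-- **THE TAUBERIAN THEOREM, BY NAME (Hardy–Littlewood 1914, Karamata 1930): A SEQUENCE BOUNDED BELOW WHOSE ABEL MEANS CONVERGE IS
(C,1)-SUMMABLE TO THE SAME VALUE.**  `b ≤ a n` for all n, `Σ a n xⁿ` summable for `0 ≤ x < 1`, `(1 − x)·Σ' a n xⁿ → m` (x → 1⁻) ⟹
`n⁻¹·Σ_{i<n} a i → m`.  Proof: the tree's `hardyLittlewood_powerSeries_iff` (Feller XIII.5 Theorem 5) at index ρ = 1 for the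
nonnegative coefficients `q n = a n − b + 1`, whose Abel limit is `m − b + 1 ≥ 1 > 0`; Γ(2) = 1. [folklore] -/
theorem cesaro_of_abel_of_bddBelow {m b : ℝ} (hb : ∀ n, b ≤ a n)
    (hsum : ∀ x : ℝ, 0 ≤ x → x < 1 → Summable fun n => a n * x ^ n)
    (habel : Tendsto (fun x : ℝ => (1 - x) * ∑' n, a n * x ^ n) (𝓝[<] 1) (𝓝 m)) :
    Tendsto (fun n : ℕ => (n : ℝ)⁻¹ * ∑ i ∈ range n, a i) atTop (𝓝 m) := by
  have hbm : b ≤ m := le_of_abel_of_bddBelow hb hsum habel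
  set q : ℕ → ℝ := fun n => a n - b + 1 with hq
  have hq0 : ∀ n, 0 ≤ q n := fun n => by simp only [hq]; linarith [hb n]
  set C : ℝ := m - b + 1 with hC
  have hC0 : 0 < C := by rw [hC]; linarith
  -- the two hypotheses of Feller's Theorem 5 for q at ρ = 1
  have hqsum : ∀ s : ℝ, 0 ≤ s → s < 1 → Summable fun n : ℕ => q n * s ^ n := by
    intro s hs0 hs1
    have := (hsum s hs0 hs1).add ((summable_geometric_of_lt_one hs0 hs1).mul_left (1 - b))
    refine this.congr fun n => ?_
    simp only [hq]; ring
  have hqlim : Tendsto (fun s : ℝ => (1 - s) ^ (1 : ℝ) * ∑' n : ℕ, q n * s ^ n) (𝓝[<] 1) (𝓝 C) := by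
    have h1 : Tendsto (fun s : ℝ => (1 - s) * ∑' n, a n * s ^ n + (1 - b)) (𝓝[<] 1) (𝓝 (m + (1 - b))) :=
      habel.add_const _
    have h2 : m + (1 - b) = C := by rw [hC]; ring
    rw [h2] at h1
    refine h1.congr' ?_
    filter_upwards [Ioo_mem_nhdsLT (show (0 : ℝ) < 1 by norm_num)] with s hs
    obtain ⟨hs0, hs1⟩ := hs
    have hg : Summable fun n : ℕ => (1 - b) * s ^ n := (summable_geometric_of_lt_one hs0.le hs1).mul_left _
    rw [Real.rpow_one]
    have hsplit : ∑' n : ℕ, q n * s ^ n = ∑' n, a n * s ^ n + ∑' n : ℕ, (1 - b) * s ^ n := by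
      rw [← (hsum s hs0.le hs1).tsum_add hg]
      exact tsum_congr fun n => by simp only [hq]; ring
    rw [hsplit, mul_add, tsum_mul_left, ← mul_assoc, mul_comm (1 - s) (1 - b), mul_assoc,
      one_sub_mul_tsum_pow hs0.le hs1, mul_one]
  have hHL := (Literature.Analysis.Asymptotics.hardyLittlewood_powerSeries_iff hq0 zero_le_one hC0).mp ⟨hqsum, hqlim⟩
  -- Γ(2) = 1 and n¹ = n
  have hΓ : Real.Gamma ((1 : ℝ) + 1) = 1 := by
    rw [show (1 : ℝ) + 1 = (1 : ℕ) + 1 by norm_num, Real.Gamma_nat_eq_factorial]; simp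
  rw [hΓ, div_one] at hHL
  have hHL' : Tendsto (fun n : ℕ => (n : ℝ)⁻¹ * ∑ k ∈ range n, q k) atTop (𝓝 C) := by
    refine hHL.congr' ?_
    filter_upwards [eventually_gt_atTop 0] with n hn
    rw [Real.rpow_one, div_eq_inv_mul]
  -- σ_n(a) = σ_n(q) + (b − 1) for n ≥ 1
  have h3 : Tendsto (fun n : ℕ => (n : ℝ)⁻¹ * ∑ k ∈ range n, q k + (b - 1)) atTop (𝓝 (C + (b - 1))) :=
    hHL'.add_const _
  have h4 : C + (b - 1) = m := by rw [hC]; ring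
  rw [h4] at h3
  refine h3.congr' ?_
  filter_upwards [eventually_gt_atTop 0] with n hn
  have hn' : (n : ℝ) ≠ 0 := Nat.cast_ne_zero.mpr (Nat.pos_iff_ne_zero.mp hn)
  have hsumq : ∑ k ∈ range n, q k = ∑ k ∈ range n, a k + n * (1 - b) := by
    simp only [hq, sum_add_distrib, sum_sub_distrib, sum_const, card_range, nsmul_eq_mul]; ring
  rw [hsumq, mul_add, ← mul_assoc, inv_mul_cancel₀ hn', one_mul]
  ring

/-- **FOR A SEQUENCE BOUNDED BELOW, ABEL-SUMMABLE ⟺ (C,1)-SUMMABLE (same value).**  (⟹ Hardy–Littlewood–Karamata by name; ⟸ the Abelian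
inclusion P2 #54a `abel_of_cesaro`, with the summability clause produced by P2 #54a `summable_mul_pow_of_cesaro`.) [folklore] -/
theorem abel_iff_cesaro_of_bddBelow {b : ℝ} (hb : ∀ n, b ≤ a n) (m : ℝ) :
    ((∀ x : ℝ, 0 ≤ x → x < 1 → Summable fun n => a n * x ^ n) ∧
        Tendsto (fun x : ℝ => (1 - x) * ∑' n, a n * x ^ n) (𝓝[<] 1) (𝓝 m)) ↔
      Tendsto (fun n : ℕ => (n : ℝ)⁻¹ * ∑ i ∈ range n, a i) atTop (𝓝 m) :=
  ⟨fun h => cesaro_of_abel_of_bddBelow hb h.1 h.2,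
    fun h => ⟨fun _ hx0 hx1 => summable_mul_pow_of_cesaro h hx0 hx1, abel_of_cesaro h⟩⟩

/-- **LITTLEWOOD ∕ SCHMIDT IN THE BOUNDED-BELOW CLASS (HEADLINE): A SLOWLY DECREASING SEQUENCE BOUNDED BELOW WHOSE ABEL MEANS CONVERGE
CONVERGES.**  `b ≤ a n`, `Σ a n xⁿ` summable on [0,1[, `(1 − x)·Σ' a n xⁿ → m`, and one-sided slow decrease — for every ε > 0 there are
q > 1 and N₀ with `a N − ε ≤ a i` whenever `N₀ ≤ N ≤ i ≤ q·N` — ⟹ **`a n → m`**: Karamata returns the Cesàro means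
(`cesaro_of_abel_of_bddBelow`), Schmidt returns the sequence (P2 #53a `tendsto_of_cesaro_slowlyDecreasing`). [folklore]
(Littlewood 1911; Schmidt 1925; Hardy, Divergent Series Thm 105) -/
theorem tendsto_of_abel_slowlyDecreasing_of_bddBelow {m b : ℝ} (hb : ∀ n, b ≤ a n)
    (hsum : ∀ x : ℝ, 0 ≤ x → x < 1 → Summable fun n => a n * x ^ n)
    (habel : Tendsto (fun x : ℝ => (1 - x) * ∑' n, a n * x ^ n) (𝓝[<] 1) (𝓝 m))
    (hsd : ∀ ε > 0, ∃ q > (1:ℝ), ∃ N₀ : ℕ, ∀ N i : ℕ, N₀ ≤ N → N ≤ i → (i : ℝ) ≤ q * N → a N - ε ≤ a i) :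
    Tendsto a atTop (𝓝 m) :=
  tendsto_of_cesaro_slowlyDecreasing (cesaro_of_abel_of_bddBelow hb hsum habel) hsd

/-- **IN THE CLASS (SO) ∩ (BOUNDED BELOW): `Abel → m ⟺ a n → m`** (⟹ the headline; ⟸ `abel_of_tendsto`, summability from boundedness).
Together with `abel_iff_cesaro_of_bddBelow` and P2 #53a `cesaro_iff_tendsto_of_slowlyOscillating`: **ABEL ⟺ (C,1) ⟺ LIMIT**. [folklore] -/
theorem abel_iff_tendsto_of_slowlyOscillating_of_bddBelow {b : ℝ} (hb : ∀ n, b ≤ a n)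
    (hso : ∀ ε > 0, ∃ q > (1:ℝ), ∃ N₀ : ℕ, ∀ N i : ℕ, N₀ ≤ N → N ≤ i → (i : ℝ) ≤ q * N → |a i - a N| ≤ ε) (m : ℝ) :
    ((∀ x : ℝ, 0 ≤ x → x < 1 → Summable fun n => a n * x ^ n) ∧
        Tendsto (fun x : ℝ => (1 - x) * ∑' n, a n * x ^ n) (𝓝[<] 1) (𝓝 m)) ↔
      Tendsto a atTop (𝓝 m) := by
  rw [abel_iff_cesaro_of_bddBelow hb m]
  exact cesaro_iff_tendsto_of_slowlyOscillating hso m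

/-! ## §2 Perturbation by a null sequence -/

/-- A sequence bounded below plus a null sequence is bounded below. [folklore] -/
theorem bddBelow_add_null {u e : ℕ → ℝ} {b : ℝ} (hb : ∀ n, b ≤ u n) (he : Tendsto e atTop (𝓝 0)) :
    ∃ b', ∀ n, b' ≤ u n + e n := by
  obtain ⟨B, hB⟩ := exists_abs_le_of_tendsto he
  exact ⟨b - B, fun n => by have := (abs_le.mp (hB n)).1; linarith [hb n]⟩

/-- **THE ABEL MEAN OF `d = u + e`, u (SO) AND BOUNDED BELOW, e → 0: `Abel(d) → m ⟺ d → m ⟺ u → m`** (the sum is again (SO) — P2 #53a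
`slowlyOscillating_add_null` — and bounded below; then `abel_iff_tendsto_of_slowlyOscillating_of_bddBelow` and P2 #53a `cesaro_add_null_iff`).
The consumer's d is the sampled deviation `c·(M(h n) − m) + e n` (P2 #54e). [folklore] -/
theorem abel_add_null_iff {u e : ℕ → ℝ} {b : ℝ} (hb : ∀ n, b ≤ u n)
    (hso : ∀ ε > 0, ∃ q > (1:ℝ), ∃ N₀ : ℕ, ∀ N i : ℕ, N₀ ≤ N → N ≤ i → (i : ℝ) ≤ q * N → |u i - u N| ≤ ε)
    (he : Tendsto e atTop (𝓝 0)) (m : ℝ) :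
    (((∀ x : ℝ, 0 ≤ x → x < 1 → Summable fun n => (u n + e n) * x ^ n) ∧
        Tendsto (fun x : ℝ => (1 - x) * ∑' n, (u n + e n) * x ^ n) (𝓝[<] 1) (𝓝 m)) ↔
        Tendsto (fun n => u n + e n) atTop (𝓝 m)) ∧
      (Tendsto (fun n => u n + e n) atTop (𝓝 m) ↔ Tendsto u atTop (𝓝 m)) := by
  obtain ⟨b', hb'⟩ := bddBelow_add_null hb he
  have hso' := slowlyOscillating_add_null hso he
  exact ⟨abel_iff_tendsto_of_slowlyOscillating_of_bddBelow (a := fun n => u n + e n) hb' hso' m,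
    (cesaro_add_null_iff hso he m).2⟩

end

end Summit.QuantumFields.BalabanUV.Beta.EriceFlowEnclosureAbelTauberianSeq
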